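import Summits.QuantumAdvantage.QuantumAdvantage.Theorems.SupportDialResidueCertificateC

/-! # SupportDial residue certificate — part D (decomp-qadv-lens-1 g7, node «ResidueDial» rev 5)

§6c part 2 + §7: rotation covariance, `twoBlockLaw2`, `momentLaw2`, `closes_final`, the rungs (5,1), (7,2) by `decide`. -/

set_option linter.dupNamespace false
set_option linter.style.longLine false
set_option linter.unusedVariables false

open Finset
open Literature.Computability.QuantumComplexity.RingHLF
open Literature.Computability.MetaComplexity.Smolensky (CubeFn mono lowDeg)
open Summit.QuantumAdvantage.AdviceFreeQNC0

namespace Summit.QuantumAdvantage.QuantumAdvantage.Theorems.SupportDialResidueCertificate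

section TwoBlockProof

section Rot
variable {k : ℕ} [NeZero k]

/-- ResidueDial helper `card_filter_rot` (lens-1 g7 ResidueDial certificate; see the enclosing section docstring). -/
theorem card_filter_rot (j : Fin k) (p : Fin k → Prop) [DecidablePred p] :
    (univ.filter fun l : Fin k => p (l + j)).card = (univ.filter p).card := by
  refine Finset.card_bij (fun l _ => l + j) (fun l hl => by simpa using hl) (fun a _ b _ h => add_right_cancel h)
    (fun b hb => ⟨b - j, by simpa [sub_add_cancel] using hb, sub_add_cancel b j⟩)

/-- ResidueDial helper `oddZ_rot` (lens-1 g7 ResidueDial certificate; see the enclosing section docstring). -/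
theorem oddZ_rot (j : Fin k) (β : Fin k → Bool) : oddZ (rotF j β) = oddZ β := by
  unfold oddZ rotF; rw [card_filter_rot j (fun l => β l = false)]

/-- ResidueDial helper `psum_rot` (lens-1 g7 ResidueDial certificate; see the enclosing section docstring). -/
theorem psum_rot (j : Fin k) (β : Fin k → Bool) (d : ℕ) : psum (rotF j β) 0 d = psum β j d := by
  unfold psum rotF
  rw [← card_filter_rot j (fun l : Fin k => (l - j).val ≤ d ∧ β l = true)]
  congr 1; ext l; simp [sub_zero, add_sub_cancel_right]

/-- ResidueDial helper `blk_rot` (lens-1 g7 ResidueDial certificate; see the enclosing section docstring). -/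
theorem blk_rot (j : Fin k) (β : Fin k → Bool) (par : ℕ) : blk (rotF j β) 0 par = blk β j par := by
  unfold blk; exact Finset.sum_congr rfl fun d _ => by rw [psum_rot]

/-- ResidueDial helper `jB_rot` (lens-1 g7 ResidueDial certificate; see the enclosing section docstring). -/
theorem jB_rot (j : Fin k) (β : Fin k → Bool) : jB (rotF j β) 0 = jB β j := by
  have hc : (univ.filter fun v : Fin k → Bool => InKernel β v ∧ v j = true).card =
      (univ.filter fun v : Fin k → Bool => InKernel (rotF j β) v ∧ v 0 = true).card := by
    refine Finset.card_bij (fun v _ => rotF j v) (fun v hv => ?_) (fun a _ b _ h => ?_) (fun w hw => ?_)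
    · simp only [Finset.mem_filter, Finset.mem_univ, true_and] at hv ⊢
      exact ⟨(inKernel_rot j β v).2 hv.1, by simpa [rotF] using hv.2⟩
    · funext l
      have := congrFun h (l - j)
      simpa [rotF, sub_add_cancel] using this
    · refine ⟨fun l => w (l - j), ?_, ?_⟩
      · simp only [Finset.mem_filter, Finset.mem_univ, true_and] at hw ⊢
        have hw1 : InKernel (rotF j β) (rotF j fun l => w (l - j)) := by
          have : (rotF j fun l => w (l - j)) = w := by funext l; simp [rotF]
          rw [this]; exact hw.1
        exact ⟨(inKernel_rot j β _).1 hw1, by simpa [zero_add] using hw.2⟩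
      · funext l; simp [rotF]
  unfold jB; rw [hc]

/-- ones strictly before position `j` -/
def pre (β : Fin k → Bool) (j : Fin k) : ℕ := (univ.filter fun l : Fin k => l < j ∧ β l = true).card

/-- B4 (parity transport): `psum β j d ≡ pre β j + psum β 0 ((j+d) mod k)` when the number of ones is even. -/
theorem psum_parity (β : Fin k → Bool) (heven : (univ.filter fun l : Fin k => β l = true).card % 2 = 0)
    (j d : Fin k) : psum β j d.val % 2 = (pre β j + psum β 0 (j + d).val) % 2 := by
  have hQ : psum β 0 (j + d).val = (univ.filter fun l : Fin k => l.val ≤ (j + d).val ∧ β l = true).card := by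
    unfold psum; congr 1; ext l; simp [sub_zero]
  rw [hQ, Fin.val_add]
  unfold psum pre
  by_cases hw : j.val + d.val < k
  · -- no wrap: Q = P ⊔ A
    rw [Nat.mod_eq_of_lt hw]
    have hunion : (univ.filter fun l : Fin k => l.val ≤ j.val + d.val ∧ β l = true) =
        (univ.filter fun l : Fin k => l < j ∧ β l = true) ∪
          (univ.filter fun l : Fin k => (l - j).val ≤ d.val ∧ β l = true) := by
      ext l
      simp only [Finset.mem_union, Finset.mem_filter, Finset.mem_univ, true_and]
      by_cases hjl : j ≤ l
      · rw [Fin.coe_sub_iff_le.2 hjl]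
        have := Fin.le_def.1 hjl
        constructor
        · rintro ⟨h1, h2⟩; exact Or.inr ⟨by omega, h2⟩
        · rintro (⟨h1, h2⟩ | ⟨h1, h2⟩)
          · exact absurd (Fin.lt_def.1 h1) (by omega)
          · exact ⟨by omega, h2⟩
      · rw [Fin.coe_sub_iff_lt.2 (not_le.1 hjl)]
        have := Fin.lt_def.1 (not_le.1 hjl)
        constructor
        · rintro ⟨h1, h2⟩; exact Or.inl ⟨not_le.1 hjl, h2⟩
        · rintro (⟨h1, h2⟩ | ⟨h1, h2⟩)
          · exact ⟨by omega, h2⟩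
          · exact absurd h1 (by omega)
    have hdisj : Disjoint (univ.filter fun l : Fin k => l < j ∧ β l = true)
        (univ.filter fun l : Fin k => (l - j).val ≤ d.val ∧ β l = true) := by
      refine Finset.disjoint_filter.2 fun l _ h1 h2 => ?_
      rw [Fin.coe_sub_iff_lt.2 h1.1] at h2
      have := Fin.lt_def.1 h1.1
      omega
    rw [hunion, Finset.card_union_of_disjoint hdisj]
    omega
  · -- wrap: A = (T \ P) ⊔ Q
    have hmod : (j.val + d.val) % k = j.val + d.val - k := by
      rw [Nat.mod_eq_sub_mod (by omega), Nat.mod_eq_of_lt (by omega)]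
    rw [hmod]
    have hTP : (univ.filter fun l : Fin k => ¬ l < j ∧ β l = true).card +
        (univ.filter fun l : Fin k => l < j ∧ β l = true).card = (univ.filter fun l : Fin k => β l = true).card := by
      rw [← Finset.card_union_of_disjoint]
      · congr 1; ext l; simp only [Finset.mem_union, Finset.mem_filter, Finset.mem_univ, true_and]
        constructor
        · rintro (⟨-, h⟩ | ⟨-, h⟩) <;> exact h
        · intro h; by_cases hl : l < j; exact Or.inr ⟨hl, h⟩; exact Or.inl ⟨hl, h⟩
      · exact Finset.disjoint_filter.2 fun l _ h1 h2 => h1.1 h2.1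
    have hunion : (univ.filter fun l : Fin k => (l - j).val ≤ d.val ∧ β l = true) =
        (univ.filter fun l : Fin k => ¬ l < j ∧ β l = true) ∪
          (univ.filter fun l : Fin k => l.val ≤ j.val + d.val - k ∧ β l = true) := by
      ext l
      simp only [Finset.mem_union, Finset.mem_filter, Finset.mem_univ, true_and]
      by_cases hjl : j ≤ l
      · rw [Fin.coe_sub_iff_le.2 hjl]
        have := Fin.le_def.1 hjl
        have hl := l.isLt
        constructor
        · rintro ⟨h1, h2⟩; exact Or.inl ⟨not_lt.2 hjl, h2⟩
        · rintro (⟨h1, h2⟩ | ⟨h1, h2⟩)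
          · exact ⟨by omega, h2⟩
          · exact ⟨by omega, h2⟩
      · rw [Fin.coe_sub_iff_lt.2 (not_le.1 hjl)]
        have := Fin.lt_def.1 (not_le.1 hjl)
        constructor
        · rintro ⟨h1, h2⟩; exact Or.inr ⟨by omega, h2⟩
        · rintro (⟨h1, h2⟩ | ⟨h1, h2⟩)
          · exact absurd (not_le.1 hjl) h1
          · exact ⟨by omega, h2⟩
    have hdisj : Disjoint (univ.filter fun l : Fin k => ¬ l < j ∧ β l = true)
        (univ.filter fun l : Fin k => l.val ≤ j.val + d.val - k ∧ β l = true) := by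
      refine Finset.disjoint_filter.2 fun l _ h1 h2 => ?_
      have hd := d.isLt
      exact h1.1 (Fin.lt_def.2 (by omega))
    rw [hunion, Finset.card_union_of_disjoint hdisj]
    omega

/-- B4': the base-`j` block total is `±` the rotation number: `E_j + O_j = (−1)^{pre} · rot3 β`. -/
theorem blk_sum_eq (β : Fin k → Bool) (heven : (univ.filter fun l : Fin k => β l = true).card % 2 = 0) (j : Fin k) :
    blk β j 0 + blk β j 1 = (-1 : ZMod 3) ^ pre β j * rot3 β := by
  have hj : blk β j 0 + blk β j 1 = ∑ d : Fin k, (-1 : ZMod 3) ^ psum β j d.val := by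
    unfold blk
    rw [Fin.sum_univ_eq_sum_range (fun d => (-1 : ZMod 3) ^ psum β j d),
      ← Finset.sum_filter_add_sum_filter_not (Finset.range k) (fun d => d % 2 = 0)]
    have hne : (Finset.range k).filter (fun d => ¬ d % 2 = 0) = (Finset.range k).filter (fun d => d % 2 = 1) :=
      Finset.filter_congr fun d _ => by omega
    rw [hne]
  have h0 : rot3 β = ∑ i : Fin k, (-1 : ZMod 3) ^ psum β 0 i.val := by
    rw [rot3_eq_blk]; unfold blk
    rw [Fin.sum_univ_eq_sum_range (fun d => (-1 : ZMod 3) ^ psum β 0 d),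
      ← Finset.sum_filter_add_sum_filter_not (Finset.range k) (fun d => d % 2 = 0)]
    have hne : (Finset.range k).filter (fun d => ¬ d % 2 = 0) = (Finset.range k).filter (fun d => d % 2 = 1) :=
      Finset.filter_congr fun d _ => by omega
    rw [hne]
  rw [hj, h0, Finset.mul_sum]
  rw [← Equiv.sum_comp (Equiv.addLeft j) (fun i : Fin k => (-1 : ZMod 3) ^ pre β j * (-1 : ZMod 3) ^ psum β 0 i.val)]
  refine Finset.sum_congr rfl fun d _ => ?_
  rw [Equiv.coe_addLeft, ← pow_add]
  exact neg_one_pow_congr (psum_parity β heven j d)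

end Rot

/-! ### C. Assembly -/

/-- ResidueDial helper `ones_even_of_oddZ` (lens-1 g7 ResidueDial certificate; see the enclosing section docstring). -/
theorem ones_even_of_oddZ {k : ℕ} (hko : k % 2 = 1) (β : Fin k → Bool) (hβ : oddZ β = true) :
    (univ.filter fun l : Fin k => β l = true).card % 2 = 0 := by
  have c4 : (univ.filter fun b : Fin k => β b = false).card + (univ.filter fun b : Fin k => β b = true).card = k := by
    have h := Finset.card_filter_add_card_filter_not (s := (univ : Finset (Fin k))) (fun b : Fin k => β b = false)
    have hneg : (univ.filter fun b : Fin k => ¬ β b = false) = univ.filter fun b : Fin k => β b = true :=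
      Finset.filter_congr fun b _ => by simp
    rw [hneg, Finset.card_univ, Fintype.card_fin] at h
    exact h
  have hz : (univ.filter fun b : Fin k => β b = false).card % 2 = 1 := by
    unfold oddZ at hβ; exact of_decide_eq_true hβ
  omega

/-- **`TwoBlockLaw2` PROVED** (all odd `k ≥ 3`, odd class, every column). -/
theorem twoBlockLaw2 : TwoBlockLaw2 := by
  intro k hk hko β hβ j
  haveI : NeZero k := ⟨by omega⟩
  have heven := ones_even_of_oddZ hko β hβ
  -- the rotated pattern
  have hγ : oddZ (rotF j β) = true := by rw [oddZ_rot]; exact hβ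
  have hγr : reflBit (List.ofFn (rotF j β)) = true :=
    (reflBit_ofFn_iff _).2 (Nat.odd_iff.2 (by unfold oddZ at hγ; exact of_decide_eq_true hγ))
  have hJ : jB β j = decide (blk β j 0 - blk β j 1 ≠ 0) := by
    rw [← jB_rot j β, jB_zero_eq hk _ hγr, sigmaSum_eq_blk hko _ hγ, blk_rot, blk_rot]
  have hR : decide (rot3 β ≠ 0) = decide (blk β j 0 + blk β j 1 ≠ 0) := by
    rw [decide_eq_decide, blk_sum_eq β heven j, neg_one_pow_eq_sgn]
    split_ifs <;> simp
  rw [hJ, hR]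
  generalize blk β j 0 = E
  generalize blk β j 1 = O
  revert E O
  decide


/-- **`MomentLaw2` is a THEOREM** (two-block identity §6c + Reed–Muller glue §6b). -/
theorem momentLaw2 : MomentLaw2 := momentOfTwoBlock2 twoBlockLaw2

/-- Hence every grade's moment hypothesis is discharged. -/
theorem momentAt_all (r : ℕ) (hr : 1 ≤ r) : MomentAt r := momentLaw2 r hr

/-- **THE NODE AFTER g7 (PROVED, 0 sorry): `SignTwistLaw2 → YStepLaw2 → SupportDial.HalfDegreeLaw2` (tree 32140 BY NAME).** -/
theorem closes_final (hS : SignTwistLaw2) (hY : YStepLaw2) :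
    Summit.QuantumAdvantage.QuantumAdvantage.Theses.SupportDial.HalfDegreeLaw2 :=
  closes momentLaw2 hS hY

/-- The odd thresholds now rest on the sign twist alone. -/
theorem oddThreshold_of_signTwist (hS : SignTwistLaw2) : OddThresholdLaw2 :=
  oddThreshold_of_moment_signTwist momentLaw2 hS

/-- Per grade: `N_{2r+3}` odd ⇒ the bare `(2r+3)`-cycle defeats 𝔽₂-degree `r`. -/
theorem smallRingLosesDeg_of_signTwistAt (r : ℕ) (hr : 1 ≤ r) (hS : SignTwistAt r) : SmallRingLosesDeg (2 * r + 3) r :=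
  smallRingLosesDeg_of_certificate r (momentAt_all r hr) hS

end TwoBlockProof

/-! ## §7 The ladder in `r`, kernel-checked at the bottom: grades `r = 1, 2` by `decide` on the CLOSED FORM -/

set_option maxRecDepth 200000 in
set_option maxHeartbeats 40000000 in
/-- Grade `r = 1` (`C₅`): the closed-form certificate annihilates every monomial column of degree `≤ 1`. -/
theorem moment_one_mono : ∀ j : Fin (2 * 1 + 3), ∀ S : Finset (Fin (2 * 1 + 3)), S.card ≤ 1 →
    (∑ β : Fin (2 * 1 + 3) → Bool, ∑ v : Fin (2 * 1 + 3) → Bool,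
      ind (lamB β && kerB β v && v j) * mono (ZMod 2) S β) = 0 := by
  decide

/-- Grade `r = 1`: `MomentAt 1` (span induction from the monomial columns). -/
theorem momentAt_one : MomentAt 1 := by
  intro j u hu
  rw [Literature.Computability.MetaComplexity.Smolensky.lowDeg_eq_span] at hu
  induction hu using Submodule.span_induction with
  | mem x hx =>
    obtain ⟨⟨S, hS⟩, rfl⟩ := hx
    exact moment_one_mono j S hS
  | zero => simp
  | add x y _ _ hx hy =>
    simp only [Pi.add_apply, mul_add, Finset.sum_add_distrib, hx, hy, add_zero]
  | smul c x _ hx =>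
    simp only [Pi.smul_apply, smul_eq_mul, mul_left_comm _ c, ← Finset.mul_sum, hx, mul_zero]

set_option maxRecDepth 200000 in
set_option maxHeartbeats 40000000 in
/-- Grade `r = 1` (`C₅`): the certificate pairs oddly with the sign bits (`N₅ = 1`: the single member is `β = 0⁵`). -/
theorem signTwistAt_one : SignTwistAt 1 := by
  unfold SignTwistAt; decide

/-- **RUNG (PROVED, closed form end-to-end): `SmallRingLosesDeg 5 1`** — the g4/g5 seed `(5,1)` re-derived in three
lines from the rotation-number certificate through the general soundness theorem. -/
theorem smallRingLosesDeg_5_1 : SmallRingLosesDeg 5 1 :=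
  smallRingLosesDeg_of_certificate 1 momentAt_one signTwistAt_one

set_option maxRecDepth 400000 in
set_option maxHeartbeats 400000000 in
/-- Grade `r = 2` (`C₇`): sign twist by `decide` on the closed form (`N₇ = 15`). -/
theorem signTwistAt_two : SignTwistAt 2 := by
  unfold SignTwistAt; decide

/-- **RUNG (PROVED): `SmallRingLosesDeg 7 2`** — the bare `7`-cycle defeats every 𝔽₂-QUADRATIC strategy on the odd class
(moment law = theorem §6c, sign twist `N₇` odd by `decide`).  First rung beyond the g4–g6 tables `(5,1)`, `(6,1)`. -/
theorem smallRingLosesDeg_7_2 : SmallRingLosesDeg 7 2 :=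
  smallRingLosesDeg_of_signTwistAt 2 (by norm_num) signTwistAt_two

set_option maxRecDepth 200000 in
set_option maxHeartbeats 40000000 in
/-- The two-block identity on `C₅`, all odd-class `β`, all `j` (`decide`). -/
theorem twoBlock_five : ∀ β : Fin 5 → Bool, oddZ β = true → ∀ j : Fin 5,
    (decide (rot3 β ≠ 0) && jB β j) = xor (decide (blk β j 0 = 0)) (decide (blk β j 1 = 0)) := by
  decide

set_option maxRecDepth 400000 in
set_option maxHeartbeats 400000000 in
/-- The two-block identity on `C₇`, all odd-class `β`, all `j` (`decide`). -/
theorem twoBlock_seven : ∀ β : Fin 7 → Bool, oddZ β = true → ∀ j : Fin 7,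
    (decide (rot3 β ≠ 0) && jB β j) = xor (decide (blk β j 0 = 0)) (decide (blk β j 1 = 0)) := by
  decide

end Summit.QuantumAdvantage.QuantumAdvantage.Theorems.SupportDialResidueCertificate
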